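import Summits.QuantumAdvantage.QuantumAdvantage.Theorems.FanInRootCollapseB
import Summits.QuantumAdvantage.QuantumAdvantage.Theorems.FanInRootSeeds3
import Summits.QuantumAdvantage.QuantumAdvantage.Theorems.FanInRootComb2

/-!
# FanInRoot (9/11): CUBIC COMBS (four teeth determine the comb) and the UNCONDITIONAL `Θ(n^{3/4})` fan-in rung `noPerfectFanInAll_threeQuarter`
-/

set_option linter.dupNamespace false -- D-0017: single-problem summit ⇒ `QuantumAdvantage.QuantumAdvantage` by design

namespace Summit.QuantumAdvantage.QuantumAdvantage.Theorems.FanInRoot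

open Finset
open Summit.QuantumAdvantage.AdviceFreeQNC0
open Literature.Computability.QuantumComplexity
open Literature.Computability.QuantumComplexity.RingHLF
open Literature.Computability.MetaComplexity
open scoped Classical

/-! ### §6j CUBIC COMBS: an UNCONDITIONAL `Θ(n^{3/4})` fan-in rung from the `r = 3` seeds `(9,3)`, `(10,3)`

Teeth `t + a·g + a²·h + a³·l` (`a < k`, `k = 9` or `10 ≡ n (mod 2)`, `g ≥ 1`, `g + h + l` odd): consecutive gaps `g + (2a+1)h + (3a²+3a+1)l ≡ g + h + l` are odd, so the comb is
even-stretch.  A comb is bad for 3-hub readers iff some `S_j` holds FOUR teeth; four teeth determine `(t,g,h,l)` (cubic Vandermonde, done by three successive divided differences over `ℤ`),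
so (bad comb) ↦ (j, a, b, c, d, teeth) is injective: `#bad ≤ 10⁴·n·f⁴` against `≥ (n/2)(n/108)(n/486)(n/4374)` combs; for `f ≤ n^{3/4}/4096`, `n ≥ 8748`, a good comb exists. -/

/-- `threeQuarterRoot n = max {m ≤ n : m⁴ ≤ n³}` (≈ `n^{3/4}`). -/
def threeQuarterRoot (n : ℕ) : ℕ := Nat.findGreatest (fun m => m ^ 4 ≤ n * n * n) n

/-- FanInRoot helper `threeQuarterRoot_le` (lens-1 g6 FanInRoot package; see the module docstring). -/
theorem threeQuarterRoot_le (n : ℕ) : threeQuarterRoot n ≤ n := Nat.findGreatest_le n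

/-- FanInRoot helper `twoThirdsRoot_le_threeQuarterRoot` (lens-1 g6 FanInRoot package; see the module docstring). -/
theorem twoThirdsRoot_le_threeQuarterRoot (n : ℕ) : twoThirdsRoot n ≤ threeQuarterRoot n := by
  unfold threeQuarterRoot
  refine Nat.le_findGreatest (twoThirdsRoot_le n) ?_
  calc twoThirdsRoot n ^ 4 = twoThirdsRoot n ^ 3 * twoThirdsRoot n := by ring
    _ ≤ (n * n) * n := Nat.mul_le_mul (Comb2.twoThirdsRoot_pow_le n) (twoThirdsRoot_le n)
    _ = n * n * n := by ring


namespace Comb3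

/-- Number of teeth of the comb: the odd value on odd `n`, the even value on even `n` (so that `n − k` is even). -/
def kOf (n : ℕ) : ℕ := if n % 2 = 1 then 9 else 10

/-- FanInRoot helper `kOf_cases` (lens-1 g6 FanInRoot package; see the module docstring). -/
theorem kOf_cases (n : ℕ) : (kOf n = 9 ∧ n % 2 = 1) ∨ (kOf n = 10 ∧ n % 2 = 0) := by
  unfold kOf; by_cases h : n % 2 = 1
  · exact Or.inl ⟨by rw [if_pos h], h⟩
  · exact Or.inr ⟨by rw [if_neg h], by omega⟩

/-- Position of the `a`-th tooth. -/
def pos (t g h l a : ℕ) : ℕ := t + a * g + a * a * h + a * a * a * l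

/-- FanInRoot helper `pos_lt_pos` (lens-1 g6 FanInRoot package; see the module docstring). -/
theorem pos_lt_pos {t g h l a b : ℕ} (hg : 0 < g) (hab : a < b) : pos t g h l a < pos t g h l b := by
  unfold pos
  have h1 : a * g < b * g := Nat.mul_lt_mul_of_pos_right hab hg
  have h2 : a * a * h ≤ b * b * h := Nat.mul_le_mul_right h (Nat.mul_le_mul hab.le hab.le)
  have h3 : a * a * a * l ≤ b * b * b * l := Nat.mul_le_mul_right l (Nat.mul_le_mul (Nat.mul_le_mul hab.le hab.le) hab.le)
  omega

/-- FanInRoot helper `pos_le_pos` (lens-1 g6 FanInRoot package; see the module docstring). -/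
theorem pos_le_pos {t g h l a b : ℕ} (hab : a ≤ b) : pos t g h l a ≤ pos t g h l b := by
  unfold pos
  have h1 : a * g ≤ b * g := Nat.mul_le_mul_right g hab
  have h2 : a * a * h ≤ b * b * h := Nat.mul_le_mul_right h (Nat.mul_le_mul hab hab)
  have h3 : a * a * a * l ≤ b * b * b * l := Nat.mul_le_mul_right l (Nat.mul_le_mul (Nat.mul_le_mul hab hab) hab)
  omega

/-- Parity of the teeth: `pos a ≡ t + a (mod 2)` when `g + h + l` is odd. -/
theorem pos_add_mod_two {t g h l : ℕ} (hghl : (g + h + l) % 2 = 1) (a b : ℕ) : (pos t g h l a + b) % 2 = (t + a + b) % 2 := by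
  unfold pos
  obtain ⟨m, rfl | rfl⟩ := Nat.even_or_odd' a
  · have : t + 2 * m * g + 2 * m * (2 * m) * h + 2 * m * (2 * m) * (2 * m) * l + b = (t + b) + 2 * (m * g + 2 * m * m * h + 4 * m * m * m * l) := by ring
    rw [this, Nat.add_mul_mod_self_left]; omega
  · have : t + (2 * m + 1) * g + (2 * m + 1) * (2 * m + 1) * h + (2 * m + 1) * (2 * m + 1) * (2 * m + 1) * l + b
        = (t + b + (g + h + l)) + 2 * (m * g + (2 * m * m + 2 * m) * h + (4 * m * m * m + 6 * m * m + 3 * m) * l) := by ring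
    rw [this, Nat.add_mul_mod_self_left]; omega

/-- The comb with the given first tooth and gap parameters, as a set of positions `< n`. -/
def comb (n t g h l k : ℕ) : Finset (Fin n) := univ.filter fun i : Fin n => ∃ a, a < k ∧ i.val = pos t g h l a

/-- FanInRoot helper `mem_comb` (lens-1 g6 FanInRoot package; see the module docstring). -/
theorem mem_comb {n t g h l k : ℕ} {i : Fin n} : i ∈ comb n t g h l k ↔ ∃ a, a < k ∧ i.val = pos t g h l a := by
  simp [comb]

/-- The `a`-th tooth of the comb as an element of `Fin n` (needs the non-wrapping hypothesis). -/
def tooth (n t g h l k : ℕ) (hlt : pos t g h l (k - 1) < n) (a : Fin k) : Fin n :=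
  ⟨pos t g h l a.val, lt_of_le_of_lt (pos_le_pos (by have := a.isLt; omega)) hlt⟩

/-- FanInRoot helper `tooth_injective` (lens-1 g6 FanInRoot package; see the module docstring). -/
theorem tooth_injective {n t g h l k : ℕ} (hlt : pos t g h l (k - 1) < n) (hg : 0 < g) : Function.Injective (tooth n t g h l k hlt) := by
  intro a b hab
  simp only [tooth, Fin.mk.injEq] at hab
  rcases lt_trichotomy a.val b.val with hlt' | heq | hgt
  · exact absurd hab (pos_lt_pos hg hlt').ne
  · exact Fin.ext heq
  · exact absurd hab.symm (pos_lt_pos hg hgt).ne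

/-- FanInRoot helper `comb_eq_image` (lens-1 g6 FanInRoot package; see the module docstring). -/
theorem comb_eq_image {n t g h l k : ℕ} (hlt : pos t g h l (k - 1) < n) : comb n t g h l k = univ.image (tooth n t g h l k hlt) := by
  ext i
  simp only [mem_comb, mem_image, mem_univ, true_and]
  constructor
  · rintro ⟨a, ha, hi⟩; exact ⟨⟨a, ha⟩, Fin.ext (by simp [tooth, hi])⟩
  · rintro ⟨a, rfl⟩; exact ⟨a.val, a.isLt, rfl⟩

/-- FanInRoot helper `card_comb` (lens-1 g6 FanInRoot package; see the module docstring). -/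
theorem card_comb {n t g h l k : ℕ} (hlt : pos t g h l (k - 1) < n) (hg : 0 < g) : (comb n t g h l k).card = k := by
  rw [comb_eq_image hlt, card_image_of_injective _ (tooth_injective hlt hg), card_univ, Fintype.card_fin]

/-- FanInRoot helper `card_comb_filter_lt` (lens-1 g6 FanInRoot package; see the module docstring). -/
theorem card_comb_filter_lt {n t g h l k : ℕ} (hlt : pos t g h l (k - 1) < n) (hg : 0 < g) (a' : Fin k) :
    ((comb n t g h l k).filter fun i => i < tooth n t g h l k hlt a').card = a'.val := by
  rw [comb_eq_image hlt, Finset.filter_image, card_image_of_injective _ (tooth_injective hlt hg)]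
  have : (univ.filter fun a : Fin k => tooth n t g h l k hlt a < tooth n t g h l k hlt a') = Finset.Iio a' := by
    ext a
    simp only [mem_filter, mem_univ, true_and, Finset.mem_Iio, tooth, Fin.lt_def]
    constructor
    · intro h'; by_contra hle; push Not at hle
      exact absurd h' (not_lt.2 (pos_le_pos hle))
    · intro h'; exact pos_lt_pos hg h'
  rw [this, Fin.card_Iio]

/-- Cubic combs with `g ≥ 1`, `g + h + l` odd and `k ≡ n (mod 2)` teeth are even-stretch. -/
theorem evenStretch_comb {n t g h l k : ℕ} (hlt : pos t g h l (k - 1) < n) (hg : 0 < g) (hghl : (g + h + l) % 2 = 1) (hkn : (n - k) % 2 = 0) :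
    comb n t g h l k ∈ EvenStretch n := by
  refine ⟨by rw [card_comb hlt hg]; exact hkn, ?_⟩
  intro i hi i' hi'
  rw [comb_eq_image hlt] at hi hi'
  simp only [mem_image, mem_univ, true_and] at hi hi'
  obtain ⟨a, rfl⟩ := hi
  obtain ⟨a', rfl⟩ := hi'
  rw [card_comb_filter_lt hlt hg a', card_comb_filter_lt hlt hg a]
  simp only [tooth]
  rw [pos_add_mod_two hghl, pos_add_mod_two hghl]; congr 1; ring

/-- FanInRoot helper `threeQuarterRoot_pow_le` (lens-1 g6 FanInRoot package; see the module docstring). -/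
theorem threeQuarterRoot_pow_le (n : ℕ) : threeQuarterRoot n ^ 4 ≤ n * n * n := by
  unfold threeQuarterRoot
  exact Nat.findGreatest_spec (P := fun m => m ^ 4 ≤ n * n * n) (Nat.zero_le n) (by simp)

/-- FanInRoot helper `quart_bound` (lens-1 g6 FanInRoot package; see the module docstring). -/
theorem quart_bound (n : ℕ) : 2 ^ 48 * (threeQuarterRoot n / 4096) ^ 4 ≤ n * n * n := by
  have h1 : 4096 * (threeQuarterRoot n / 4096) ≤ threeQuarterRoot n := Nat.mul_div_le _ 4096
  calc 2 ^ 48 * (threeQuarterRoot n / 4096) ^ 4 = (4096 * (threeQuarterRoot n / 4096)) ^ 4 := by ring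
    _ ≤ threeQuarterRoot n ^ 4 := Nat.pow_le_pow_left h1 4
    _ ≤ n * n * n := threeQuarterRoot_pow_le n

/-- The CUBIC VANDERMONDE step: four teeth determine the cubic comb. -/
theorem comb_determined {t g h l t' g' h' l' a b c d P Q R U : ℕ} (hab : a ≠ b) (hac : a ≠ c) (had : a ≠ d) (hbc : b ≠ c) (hbd : b ≠ d) (hcd : c ≠ d)
    (e1 : P = pos t g h l a) (e1' : P = pos t' g' h' l' a) (e2 : Q = pos t g h l b) (e2' : Q = pos t' g' h' l' b)
    (e3 : R = pos t g h l c) (e3' : R = pos t' g' h' l' c) (e4 : U = pos t g h l d) (e4' : U = pos t' g' h' l' d) :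
    t = t' ∧ g = g' ∧ h = h' ∧ l = l' := by
  unfold pos at *
  have E1 : (t : ℤ) + a * g + a * a * h + a * a * a * l = t' + a * g' + a * a * h' + a * a * a * l' := by exact_mod_cast e1.symm.trans e1'
  have E2 : (t : ℤ) + b * g + b * b * h + b * b * b * l = t' + b * g' + b * b * h' + b * b * b * l' := by exact_mod_cast e2.symm.trans e2'
  have E3 : (t : ℤ) + c * g + c * c * h + c * c * c * l = t' + c * g' + c * c * h' + c * c * c * l' := by exact_mod_cast e3.symm.trans e3'
  have E4 : (t : ℤ) + d * g + d * d * h + d * d * d * l = t' + d * g' + d * d * h' + d * d * d * l' := by exact_mod_cast e4.symm.trans e4'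
  have F12 : ((b : ℤ) - a) * (((g : ℤ) - g') + ((a : ℤ) + b) * ((h : ℤ) - h') + ((a : ℤ) * a + a * b + b * b) * ((l : ℤ) - l')) = 0 := by
    linear_combination E2 - E1
  have F13 : ((c : ℤ) - a) * (((g : ℤ) - g') + ((a : ℤ) + c) * ((h : ℤ) - h') + ((a : ℤ) * a + a * c + c * c) * ((l : ℤ) - l')) = 0 := by
    linear_combination E3 - E1
  have F14 : ((d : ℤ) - a) * (((g : ℤ) - g') + ((a : ℤ) + d) * ((h : ℤ) - h') + ((a : ℤ) * a + a * d + d * d) * ((l : ℤ) - l')) = 0 := by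
    linear_combination E4 - E1
  have hba : ((b : ℤ) - a) ≠ 0 := sub_ne_zero.2 (by exact_mod_cast hab.symm)
  have hca : ((c : ℤ) - a) ≠ 0 := sub_ne_zero.2 (by exact_mod_cast hac.symm)
  have hda : ((d : ℤ) - a) ≠ 0 := sub_ne_zero.2 (by exact_mod_cast had.symm)
  have X12 := (mul_eq_zero.1 F12).resolve_left hba
  have X13 := (mul_eq_zero.1 F13).resolve_left hca
  have X14 := (mul_eq_zero.1 F14).resolve_left hda
  have G23 : ((c : ℤ) - b) * (((h : ℤ) - h') + ((a : ℤ) + b + c) * ((l : ℤ) - l')) = 0 := by linear_combination X13 - X12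
  have G24 : ((d : ℤ) - b) * (((h : ℤ) - h') + ((a : ℤ) + b + d) * ((l : ℤ) - l')) = 0 := by linear_combination X14 - X12
  have hcb : ((c : ℤ) - b) ≠ 0 := sub_ne_zero.2 (by exact_mod_cast hbc.symm)
  have hdb : ((d : ℤ) - b) ≠ 0 := sub_ne_zero.2 (by exact_mod_cast hbd.symm)
  have Y3 := (mul_eq_zero.1 G23).resolve_left hcb
  have Y4 := (mul_eq_zero.1 G24).resolve_left hdb
  have Z : ((d : ℤ) - c) * ((l : ℤ) - l') = 0 := by linear_combination Y4 - Y3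
  have hdc : ((d : ℤ) - c) ≠ 0 := sub_ne_zero.2 (by exact_mod_cast hcd.symm)
  have Hl : (l : ℤ) = l' := by have := (mul_eq_zero.1 Z).resolve_left hdc; omega
  have Hh : (h : ℤ) = h' := by rw [Hl, sub_self, mul_zero, add_zero] at Y3; omega
  have Hg : (g : ℤ) = g' := by rw [Hh, Hl, sub_self, sub_self, mul_zero, mul_zero, add_zero, add_zero] at X12; omega
  have Ht : (t : ℤ) = t' := by rw [Hg, Hh, Hl] at E1; linarith
  exact ⟨by exact_mod_cast Ht, by exact_mod_cast Hg, by exact_mod_cast Hh, by exact_mod_cast Hl⟩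

/-- Four distinct members of a finset of card `> 3`. -/
theorem four_of_card {α : Type*} [DecidableEq α] {A : Finset α} (hA : 3 < A.card) :
    ∃ i₁ i₂ i₃ i₄, i₁ ∈ A ∧ i₂ ∈ A ∧ i₃ ∈ A ∧ i₄ ∈ A ∧ i₁ ≠ i₂ ∧ i₁ ≠ i₃ ∧ i₁ ≠ i₄ ∧ i₂ ≠ i₃ ∧ i₂ ≠ i₄ ∧ i₃ ≠ i₄ := by
  have hne : A.Nonempty := Finset.card_pos.1 (by omega)
  obtain ⟨i₁, hi₁⟩ := hne
  have h3 : 2 < (A.erase i₁).card := by rw [Finset.card_erase_of_mem hi₁]; omega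
  obtain ⟨i₂, i₃, i₄, h₂, h₃, h₄, h23, h24, h34⟩ := Finset.two_lt_card_iff.1 h3
  obtain ⟨h21, hA2⟩ := Finset.mem_erase.1 h₂
  obtain ⟨h31, hA3⟩ := Finset.mem_erase.1 h₃
  obtain ⟨h41, hA4⟩ := Finset.mem_erase.1 h₄
  exact ⟨i₁, i₂, i₃, i₄, hi₁, hA2, hA3, hA4, Ne.symm h21, Ne.symm h31, Ne.symm h41, h23, h24, h34⟩

/-- **CUBIC COMB SELECTION THEOREM.**  For `n ≥ 8748`, against reading sets of size `≤ n^{3/4}/4096` there is an admissible cubic comb with `kOf n ∈ {9,10}` teeth met at most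
three times by every reading set. -/
theorem comb_select (n : ℕ) (hn : 8748 ≤ n) (S : Fin n → Finset (Fin n)) (hS : ∀ j, (S j).card ≤ threeQuarterRoot n / 4096) :
    ∃ t g h l : ℕ, 0 < g ∧ (g + h + l) % 2 = 1 ∧ pos t g h l (kOf n - 1) < n ∧ ∀ j, (S j ∩ comb n t g h l (kOf n)).card ≤ 3 := by
  set k := kOf n with hkdef
  set f := threeQuarterRoot n / 4096 with hfdef
  have hk : k = 9 ∨ k = 10 := by rcases kOf_cases n with ⟨h, -⟩ | ⟨h, -⟩ <;> simp [hkdef, h]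
  have hk10 : k ≤ 10 := by omega
  let T : Finset ℕ := Finset.range (n / 2)
  let GHL : Finset (ℕ × ℕ × ℕ) :=
    ((Finset.range (n / 54 + 1)) ×ˢ ((Finset.range (n / 486 + 1)) ×ˢ (Finset.range (n / 4374 + 1)))).filter fun ghl => 1 ≤ ghl.1 ∧ (ghl.1 + ghl.2.1 + ghl.2.2) % 2 = 1
  let D : Finset (ℕ × (ℕ × ℕ × ℕ)) := T ×ˢ GHL
  have hD_ok : ∀ p ∈ D, 0 < p.2.1 ∧ (p.2.1 + p.2.2.1 + p.2.2.2) % 2 = 1 ∧ pos p.1 p.2.1 p.2.2.1 p.2.2.2 (k - 1) < n := by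
    intro p hp
    simp only [D, T, GHL, mem_product, mem_range, mem_filter] at hp
    obtain ⟨ht, ⟨hg, hh, hl⟩, hg1, hpar⟩ := hp
    refine ⟨hg1, hpar, ?_⟩
    unfold pos
    have h9 : k - 1 ≤ 9 := by omega
    have h1 : (k - 1) * p.2.1 ≤ 9 * p.2.1 := Nat.mul_le_mul_right _ h9
    have h81 : (k - 1) * (k - 1) ≤ 9 * 9 := Nat.mul_le_mul h9 h9
    have h2 : (k - 1) * (k - 1) * p.2.2.1 ≤ 81 * p.2.2.1 := Nat.mul_le_mul_right _ h81
    have h729 : (k - 1) * (k - 1) * (k - 1) ≤ 9 * 9 * 9 := Nat.mul_le_mul h81 h9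
    have h3 : (k - 1) * (k - 1) * (k - 1) * p.2.2.2 ≤ 729 * p.2.2.2 := Nat.mul_le_mul_right _ h729
    omega
  by_contra hnone
  push Not at hnone
  have hbad : ∀ p ∈ D, ∃ w : Fin n × Fin 10 × Fin 10 × Fin 10 × Fin 10 × Fin n × Fin n × Fin n × Fin n,
      w.2.2.2.2.2.1 ∈ S w.1 ∧ w.2.2.2.2.2.2.1 ∈ S w.1 ∧ w.2.2.2.2.2.2.2.1 ∈ S w.1 ∧ w.2.2.2.2.2.2.2.2 ∈ S w.1 ∧
      w.2.1.val ≠ w.2.2.1.val ∧ w.2.1.val ≠ w.2.2.2.1.val ∧ w.2.1.val ≠ w.2.2.2.2.1.val ∧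
      w.2.2.1.val ≠ w.2.2.2.1.val ∧ w.2.2.1.val ≠ w.2.2.2.2.1.val ∧ w.2.2.2.1.val ≠ w.2.2.2.2.1.val ∧
      w.2.2.2.2.2.1.val = pos p.1 p.2.1 p.2.2.1 p.2.2.2 w.2.1.val ∧ w.2.2.2.2.2.2.1.val = pos p.1 p.2.1 p.2.2.1 p.2.2.2 w.2.2.1.val ∧
      w.2.2.2.2.2.2.2.1.val = pos p.1 p.2.1 p.2.2.1 p.2.2.2 w.2.2.2.1.val ∧ w.2.2.2.2.2.2.2.2.val = pos p.1 p.2.1 p.2.2.1 p.2.2.2 w.2.2.2.2.1.val := by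
    intro p hp
    obtain ⟨hg0, hpar, hlt⟩ := hD_ok p hp
    obtain ⟨j, hj⟩ := hnone p.1 p.2.1 p.2.2.1 p.2.2.2 hg0 hpar hlt
    obtain ⟨i₁, i₂, i₃, i₄, h₁, h₂, h₃, h₄, h12, h13, h14, h23, h24, h34⟩ := four_of_card hj
    obtain ⟨hi₁, hc₁⟩ := Finset.mem_inter.1 h₁
    obtain ⟨hi₂, hc₂⟩ := Finset.mem_inter.1 h₂
    obtain ⟨hi₃, hc₃⟩ := Finset.mem_inter.1 h₃
    obtain ⟨hi₄, hc₄⟩ := Finset.mem_inter.1 h₄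
    obtain ⟨a, ha, hia⟩ := mem_comb.1 hc₁
    obtain ⟨b, hb, hib⟩ := mem_comb.1 hc₂
    obtain ⟨c, hc, hic⟩ := mem_comb.1 hc₃
    obtain ⟨d, hd, hid⟩ := mem_comb.1 hc₄
    refine ⟨(j, ⟨a, by omega⟩, ⟨b, by omega⟩, ⟨c, by omega⟩, ⟨d, by omega⟩, i₁, i₂, i₃, i₄), hi₁, hi₂, hi₃, hi₄, ?_, ?_, ?_, ?_, ?_, ?_, hia, hib, hic, hid⟩
    · rintro (hab : a = b); exact h12 (Fin.ext (by rw [hia, hib, hab]))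
    · rintro (hac : a = c); exact h13 (Fin.ext (by rw [hia, hic, hac]))
    · rintro (had : a = d); exact h14 (Fin.ext (by rw [hia, hid, had]))
    · rintro (hbc : b = c); exact h23 (Fin.ext (by rw [hib, hic, hbc]))
    · rintro (hbd : b = d); exact h24 (Fin.ext (by rw [hib, hid, hbd]))
    · rintro (hcd : c = d); exact h34 (Fin.ext (by rw [hic, hid, hcd]))
  haveI : Nonempty (Fin n × Fin 10 × Fin 10 × Fin 10 × Fin 10 × Fin n × Fin n × Fin n × Fin n) :=
    ⟨(⟨0, by omega⟩, 0, 0, 0, 0, ⟨0, by omega⟩, ⟨0, by omega⟩, ⟨0, by omega⟩, ⟨0, by omega⟩)⟩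
  choose! Ψ hΨ using hbad
  let W : Finset (Fin n × Fin 10 × Fin 10 × Fin 10 × Fin 10 × Fin n × Fin n × Fin n × Fin n) :=
    (univ : Finset (Fin n × Fin 10 × Fin 10 × Fin 10 × Fin 10)).biUnion fun q =>
      ((((S q.1) ×ˢ (S q.1)) ×ˢ (S q.1)) ×ˢ (S q.1)).image fun iiii => (q.1, q.2.1, q.2.2.1, q.2.2.2.1, q.2.2.2.2, iiii.1.1.1, iiii.1.1.2, iiii.1.2, iiii.2)
  have hmaps : ∀ p ∈ D, Ψ p ∈ W := by
    intro p hp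
    obtain ⟨h1, h2, h3, h4, -⟩ := hΨ p hp
    rw [Finset.mem_biUnion]
    refine ⟨((Ψ p).1, (Ψ p).2.1, (Ψ p).2.2.1, (Ψ p).2.2.2.1, (Ψ p).2.2.2.2.1), mem_univ _, ?_⟩
    rw [Finset.mem_image]
    exact ⟨((((Ψ p).2.2.2.2.2.1, (Ψ p).2.2.2.2.2.2.1), (Ψ p).2.2.2.2.2.2.2.1), (Ψ p).2.2.2.2.2.2.2.2),
      Finset.mem_product.2 ⟨Finset.mem_product.2 ⟨Finset.mem_product.2 ⟨h1, h2⟩, h3⟩, h4⟩, rfl⟩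
  have hinj : Set.InjOn Ψ D := by
    intro p hp p' hp' heq
    obtain ⟨-, -, -, -, hab, hac, had, hbc, hbd, hcd, e1, e2, e3, e4⟩ := hΨ p hp
    obtain ⟨-, -, -, -, -, -, -, -, -, -, e1', e2', e3', e4'⟩ := hΨ p' hp'
    rw [heq] at hab hac had hbc hbd hcd e1 e2 e3 e4
    obtain ⟨ht, hg, hh, hl⟩ := comb_determined hab hac had hbc hbd hcd e1 e1' e2 e2' e3 e3' e4 e4'
    exact Prod.ext ht (Prod.ext hg (Prod.ext hh hl))
  have hcard : D.card ≤ W.card := Finset.card_le_card_of_injOn Ψ hmaps hinj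
  have hW : W.card ≤ n * 10000 * f ^ 4 := by
    calc W.card ≤ ∑ q : Fin n × Fin 10 × Fin 10 × Fin 10 × Fin 10,
            (((((S q.1) ×ˢ (S q.1)) ×ˢ (S q.1)) ×ˢ (S q.1)).image fun iiii => (q.1, q.2.1, q.2.2.1, q.2.2.2.1, q.2.2.2.2, iiii.1.1.1, iiii.1.1.2, iiii.1.2, iiii.2)).card :=
          Finset.card_biUnion_le
      _ ≤ ∑ q : Fin n × Fin 10 × Fin 10 × Fin 10 × Fin 10, f ^ 4 := Finset.sum_le_sum fun q _ => by
          refine le_trans Finset.card_image_le ?_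
          rw [Finset.card_product, Finset.card_product, Finset.card_product]
          calc (S q.1).card * (S q.1).card * (S q.1).card * (S q.1).card ≤ f * f * f * f :=
                Nat.mul_le_mul (Nat.mul_le_mul (Nat.mul_le_mul (hS _) (hS _)) (hS _)) (hS _)
            _ = f ^ 4 := by ring
      _ = n * 10000 * f ^ 4 := by
          rw [Finset.sum_const, Finset.card_univ, smul_eq_mul, Fintype.card_prod, Fintype.card_prod, Fintype.card_prod, Fintype.card_prod,
            Fintype.card_fin, Fintype.card_fin]
  have hDcard : D.card = (n / 2) * GHL.card := by simp [D, T, Finset.card_product]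
  have hGHL : (n / 54 / 2) * ((n / 486 + 1) * (n / 4374 + 1)) ≤ GHL.card := by
    have : ((Finset.range (n / 54 / 2)) ×ˢ ((Finset.range (n / 486 + 1)) ×ˢ (Finset.range (n / 4374 + 1)))).card ≤ GHL.card := by
      refine Finset.card_le_card_of_injOn (fun ihl => (2 * ihl.1 + 1 + (ihl.2.1 + ihl.2.2) % 2, ihl.2)) (fun ihl hihl => ?_) (fun ihl _ ihl' _ h => ?_)
      · simp only [GHL, mem_product, mem_range, mem_filter, Finset.mem_coe] at hihl ⊢
        omega
      · simp only [Prod.mk.injEq] at h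
        exact Prod.ext (by omega) h.2
    simpa [Finset.card_product] using this
  have hf : 2 ^ 48 * f ^ 4 ≤ n * n * n := quart_bound n
  -- final count, through q = n / 8748
  set q := n / 8748 with hqdef
  have hq : 1 ≤ q := by omega
  have hX : 2 ^ 48 * (n * 10000 * f ^ 4) ≤ 10000 * n ^ 4 := by
    calc 2 ^ 48 * (n * 10000 * f ^ 4) = 10000 * n * (2 ^ 48 * f ^ 4) := by ring
      _ ≤ 10000 * n * (n * n * n) := Nat.mul_le_mul_left _ hf
      _ = 10000 * n ^ 4 := by ring
  have hN : n ^ 4 < 8748 ^ 4 * (q + 1) ^ 4 := by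
    have h1 : n < 8748 * (q + 1) := by omega
    calc n ^ 4 < (8748 * (q + 1)) ^ 4 := Nat.pow_lt_pow_left h1 (by norm_num)
      _ = 8748 ^ 4 * (q + 1) ^ 4 := by ring
  have hC : (q + 1) ^ 4 ≤ 16 * q ^ 4 := by
    calc (q + 1) ^ 4 ≤ (2 * q) ^ 4 := Nat.pow_le_pow_left (by omega) 4
      _ = 16 * q ^ 4 := by ring
  have hY : 12754584 * q ^ 4 ≤ (n / 2) * GHL.card := by
    have hA : 4374 * q ≤ n / 2 := by omega
    have hB : 81 * q ≤ n / 54 / 2 := by omega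
    have hC' : 18 * q ≤ n / 486 + 1 := by omega
    have hD' : 2 * q ≤ n / 4374 + 1 := by omega
    calc 12754584 * q ^ 4 = (4374 * q) * ((81 * q) * ((18 * q) * (2 * q))) := by ring
      _ ≤ (n / 2) * ((n / 54 / 2) * ((n / 486 + 1) * (n / 4374 + 1))) := Nat.mul_le_mul hA (Nat.mul_le_mul hB (Nat.mul_le_mul hC' hD'))
      _ ≤ (n / 2) * GHL.card := Nat.mul_le_mul_left _ hGHL
  have hlt : n * 10000 * f ^ 4 < D.card := by rw [hDcard]; linarith
  omega

end Comb3

/-! ### The TABLE LAW `r = 3` and the `Θ(n^{3/4})` FAN-IN RUNG -/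

/-- **TABLE LAW, `r = 3`:** every even-stretch configuration of 9 or 10 hubs defeats three-hub readers. -/
theorem hubLoses_three' {n : ℕ} (H : Finset (Fin n)) (hE : H ∈ EvenStretch n) (h910 : H.card = 9 ∨ H.card = 10) : H ∈ HubLoses n 3 := by
  refine hubLoses_of_hubLosesDeg (collapseLaw3 n 3 H hE (by omega) ?_)
  rcases h910 with h | h
  · rw [h]; exact smallRingLosesDeg_9_3
  · rw [h]; exact smallRingLosesDeg_10_3

/-- **THEOREM (UNCONDITIONAL, DEGREE-FREE).**  On `C_n`, `n ≥ 8748`, NO strategy all of whose outputs read at most `n^{3/4}/4096` inputs is perfect on the odd class. -/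
theorem noPerfectFanInAll_threeQuarter : (fun n => threeQuarterRoot n / 4096) ∈ NoPerfectFanInAll := by
  refine ⟨8748, fun n hn z hz => ?_⟩
  choose S hS using hz
  obtain ⟨t, g, h, l, hg0, hghl, hlt, hmeet⟩ := Comb3.comb_select n hn S fun j => (hS j).1
  have hkn : (n - Comb3.kOf n) % 2 = 0 := by
    rcases Comb3.kOf_cases n with ⟨hk, hn2⟩ | ⟨hk, hn2⟩ <;> rw [hk] <;> omega
  have hE : Comb3.comb n t g h l (Comb3.kOf n) ∈ EvenStretch n := Comb3.evenStretch_comb hlt hg0 hghl hkn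
  have h910 : (Comb3.comb n t g h l (Comb3.kOf n)).card = 9 ∨ (Comb3.comb n t g h l (Comb3.kOf n)).card = 10 := by
    rw [Comb3.card_comb hlt hg0]
    rcases Comb3.kOf_cases n with ⟨hk, -⟩ | ⟨hk, -⟩
    · exact Or.inl hk
    · exact Or.inr hk
  obtain ⟨x, -, hox, hrel⟩ := hubLoses_three' _ hE h910 z fun j =>
    ⟨S j ∩ Comb3.comb n t g h l (Comb3.kOf n), Finset.inter_subset_right, hmeet j,
      fun x x' hx hx' hR => dep_on_hubs (hS j).2 x x' hx hx' hR⟩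
  exact ⟨x, hox, hrel⟩

/-- **RUNG R¾′:** no perfect constant-degree strategy with all fan-ins `≤ n^{3/4}/4096`. -/
theorem noPerfectFanInThreeQuarter3 : (fun n => threeQuarterRoot n / 4096) ∈ NoPerfectFanIn3 := noPerfectFanIn3_of_all noPerfectFanInAll_threeQuarter

end Summit.QuantumAdvantage.QuantumAdvantage.Theorems.FanInRoot
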